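import Summits.Ventures.HodgeRepro.RouteCReflexModel
import Summits.Ventures.HodgeRepro.T3SeesawSigns

/-!
# The character of a corner with a given eigen-embedding (T3.3, the dictionary on the group model)

Blind re-derivation cell `pub-hodge-repro`, Tier 3, seat `t3-p2` (prover-pub-hodge-repro-t3-p2-g0-0), sub-goal T3.3 of
`route/TIER3.md` (the witness `X` at `n = 3`).  Target tree path `lean/Summits/Ventures/HodgeRepro/T3CornerCharacter.lean`.
Imports: night-1's `RouteCReflexModel` (`liuType Φ = Φ⁻¹`, `liuType_rmul`) and this seat's `T3SeesawSigns`.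

`proofs/t3-p2/R3R4-INSTANTIATION.md` §4.1 attaches to a corner `T` (a CM type of the Galois CM field `E′`, group model
`(G, c)`) and an eigen-embedding `x ∈ T` the conjugate-symplectic weight-one character `μ_{T,x}` whose CM type (Liu 2021
Def 4.3, arXiv:2102.11518 p0018:L37–42) is `x • T⁻¹`; its Albanese factor `A_μ` (Liu Cor 4.20, p0023:L45–56) has CM type the
lift of the reflex of `(E′, x • T⁻¹)`, which on the model is the right twist `T·x⁻¹` = «`A_T` with `E′` acting through
`x⁻¹`» (night-1's `liuType`: `reflex(E′, liuType Φ) = (E′^{rstab Φ}, Φ)`), and the `(μ, ε, ν)`-summand of Liu Prop 4.13 is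
HOLOMORPHIC at the ball place `τ′ = 1` iff `1 ∈ Φ_μ` (Liu Lemma 10.2(2), p0057:L21–23, with Def 4.12).  This file records the
three model facts behind that dictionary:

* `cmType_eigen_eq_liuType_rmul` — `x • liuType T = liuType (rmul T x⁻¹)`: the character of `(T, x)` is Liu's character
  of the right-twisted corner `T·x⁻¹` (so `A_{μ_{T,x}} ∼ A_T` by the route's twist rule, ROUTE.md §0);
* `one_mem_smul_liuType_iff` — `1 ∈ x • liuType T ↔ x ∈ T`: the summand is holomorphic exactly for the eigen-embeddings of
  the corner;
* `mem_smul_liuType_iff` — `g ∈ x • liuType T ↔ g⁻¹ * x ∈ T` (the sign of the skew-hermitian line at `g`, Liu Def 4.12);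
* `isCMType_smul_liuType` — `x • liuType T` is a CM type (so Dimitrov–Ramakrishnan 2015 Lemma 3.5 applies to it);
* `sumTwo_card_smul_liuType` — the real-place half of N1 in this vocabulary (paper note §4.4).

Nothing here says anything about the status of the Hodge conjecture for CM abelian varieties, which is NOT proved.
-/

set_option autoImplicit false

open Finset
open scoped Pointwise

namespace HodgeRepro

namespace T3.CornerCharacter

open HodgeRepro.RouteC (liuType liuType_rmul mem_liuType isCMType_liuType)

variable {G : Type*} [Group G] [DecidableEq G]

/-- The CM type `x • T⁻¹` of the character attached to the corner `T` with eigen-embedding `x` is Liu's type of the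
right-twisted corner `T·x⁻¹`. -/
theorem cmType_eigen_eq_liuType_rmul (T : Finset G) (x : G) :
    x • liuType T = liuType (rmul T x⁻¹) := by
  rw [liuType_rmul, inv_inv]

/-- `1 ∈ x • T⁻¹ ↔ x ∈ T`: the `(μ_{T,x}, ε, ν)`-summand is holomorphic at the base embedding exactly when `x` is an
eigen-embedding of the corner. -/
theorem one_mem_smul_liuType_iff (T : Finset G) (x : G) : 1 ∈ x • liuType T ↔ x ∈ T := by
  rw [← Finset.inv_smul_mem_iff, smul_eq_mul, mul_one, mem_liuType, inv_inv]

/-- Membership in the character's CM type: `g ∈ x • T⁻¹ ↔ g⁻¹ * x ∈ T` (the skew-hermitian line of `(T, x)` is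
negative at the embedding `g` iff this holds — Liu Def 4.12, p0020:L44–50; = `T3SeesawSigns.mem_smul_inv_iff` read
through `liuType`). -/
theorem mem_smul_liuType_iff (T : Finset G) (x g : G) : g ∈ x • liuType T ↔ g⁻¹ * x ∈ T := by
  rw [← Finset.inv_smul_mem_iff, smul_eq_mul, mem_liuType, mul_inv_rev, inv_inv]

/-- `x • T⁻¹` is a CM type of `(G, c)` whenever `T` is (so Dimitrov–Ramakrishnan 2015 Lemma 3.5 produces a
conjugate-symplectic weight-one character with this CM type). -/
theorem isCMType_smul_liuType [Fintype G] {c : G} (hc : IsComplexConj c) {T : Finset G} (hT : IsCMType c T)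
    (x : G) :
    IsCMType c (x • liuType T) :=
  (isCMType_liuType hc hT).smul hc x

/-- **N1's real-place half in the vocabulary of `liuType`**: for a face `T` and embeddings `s`, `g`, the number of corners
`i ∋ s` whose character `μ_{T i, s}` has `g` in its CM type `s • (T i)⁻¹` equals the number of corners `i ∋ c * s` whose
character `μ_{T i, c s}` has `g` in its CM type `(c * s) • (T i)⁻¹` — the two counts of negative lines of the seesaw planes
`W`, `W′` at the real place of `g` (`proofs/t3-p2/R3R4-INSTANTIATION.md` §4.4). -/
theorem sumTwo_card_smul_liuType {ι : Type*} [Fintype ι] {c : G} (hc : IsComplexConj c) (T : ι → Finset G)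
    (hT : ∀ i, IsCMType c (T i)) (h2 : SumTwo T) (h4 : Fintype.card ι = 4) (s g : G) :
    ((univ.filter fun i => s ∈ T i).filter fun i => g ∈ s • liuType (T i)).card
      = ((univ.filter fun i => c * s ∈ T i).filter fun i => g ∈ (c * s) • liuType (T i)).card := by
  have key := T3.SeesawSigns.sumTwo_card_inter_eq_card_conj T hT h2 h4 s (g⁻¹ * s)
  have e1 : ((univ.filter fun i => s ∈ T i).filter fun i => g ∈ s • liuType (T i))
      = (univ.filter fun i => s ∈ T i).filter fun i => g⁻¹ * s ∈ T i :=
    filter_congr fun i _ => mem_smul_liuType_iff (T i) s g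
  have e2 : ((univ.filter fun i => c * s ∈ T i).filter fun i => g ∈ (c * s) • liuType (T i))
      = (univ.filter fun i => c * s ∈ T i).filter fun i => c * (g⁻¹ * s) ∈ T i := by
    refine filter_congr fun i _ => ?_
    rw [mem_smul_liuType_iff, ← mul_assoc, ← hc.comm g⁻¹, mul_assoc]
  rw [e1, e2, key]

end T3.CornerCharacter

end HodgeRepro
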